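import Mathlib
import HarnessLib
import Literature.Probability.MarkovChains.MetropolisHastings
import Summits.Ventures.LatticeQCDFlow.Exactness.NoisyAcceptBias

/-!
# LatticeQCDFlow / Exactness — ONE fresh pseudofermion shared by numerator and denominator is
# exact (heat-bath + Metropolis); averaging TWO such estimates under the `min` is not

HONEST FRAMING: exact (Metropolis-corrected) sampling algorithms for lattice gauge theory;
figures of merit are autocorrelation/cost numbers at stated couplings and volumes; no
continuum-physics claim.

Venture `LatticeQCDFlow` (cell pub-lqcd), topic `Exactness`; landed by FANOUT row 38 (r2-scope,
gen 4) as the Lean face of the CORRECTION of the planted control X-5a in HOME/R2-SCOPE.md §5.2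
(v1.0.9): the fresh-noise determinant-ratio acceptance is INVALID only when the estimator lacks the
reversal symmetry below — independent noises for the two states (`NoisyAcceptBias.lean`,
`mcwm₂_not_stationary`) or an average of several estimates under the `min` (this file) — whereas a
SINGLE fresh pseudofermion drawn from the current state's conditional and used in BOTH the
numerator and the denominator is the Gibbs / heat-bath-plus-Metropolis scheme and is exact.  NEW
WORK of the cell (elementary finite arithmetic), not a published result; printed counterparts are
named in docstrings only: Knechtli–Wolff, Nucl. Phys. B 663 (2003) 3, §4.1 ("shows detailed
balance … by changing variables `η → Mη`"; "If we average under the `min` function, `N_η = 1` seems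
to be the only finite value for which detailed balance can be shown"); Finkenrath–Knechtli–Leder,
Comput. Phys. Commun. 184 (2013) 1522, App. A.2 ("it is not possible to perform the average of the
argument under the `min` function over many pseudofermions, as this violates detailed balance");
Albergo et al., PRD 104 (2021) 114507, §III.B (Gibbs sampler `A_G`).

Setting (finite).  A joint positive weight `p x φ` on `X × Φ` (gauge field `x`, pseudofermion
`φ`) with `X`-marginal `margX p x = Σ_φ p x φ` (the exact-determinant gauge law) and heat-bath
conditional `hbCond p x φ = p x φ / margX p x`.  One update of the gauge field: draw `φ` from the
CURRENT state's conditional, propose `y ∼ T x ·`, accept with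
`min {1, p y φ · T y x / (p x φ · T x y)}` — the Metropolis–Hastings rate for the conditional target
`p · φ` at the shared noise `φ`.  Averaged over `φ` this is the Markov rate `hbRate` on `X`.

Results (all proved):
* `margX_mul_hbRate` — `margX p x · hbRate T p x y = Σ_φ min (p x φ · T x y) (p y φ · T y x)`,
  symmetric in `x, y`; hence `hb_detailedBalance`, `hbKernel_sum_eq_one`, `hb_isStationary`: the
  exact-determinant marginal IS stationary — ONE fresh shared pseudofermion is exact (finite face
  of Knechtli–Wolff's `⟨w₀(A,A')⟩_η / ⟨w₀(A',A)⟩_η = |det M|⁻²`).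
* `hbRate_le_mhRate` — its acceptance is at most that of the exact-ratio Metropolis–Hastings step
  for `margX p` (Knechtli–Wolff's "Carnot" bound `∫ min[ρ(η), ρ(Mη)] ≤ min(1, |det M|⁻²)`).
* `avg₂Rate`, `avg₂Kernel` — the same update with the ARGUMENT of the `min` replaced by the average
  of TWO independent shared-noise ratio estimates (each of which alone would be exact).
* THE WITNESS (`X = Φ = Fin 2`, joint weight `pj₂ = ((1/4, 1/12), (1/6, 1/2))`, marginal
  `π₂ = (1/3, 2/3)` of `NoisyAcceptBias.lean`, uniform proposals `T₂`): `hbRate` entries `3/8` and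
  `3/16` (detailed balance `(1/3)(3/8) = (2/3)(3/16)`, `hb₂_isStationary`); `avg₂Rate` entries
  `13/32` and `15/64` — HIGHER acceptance both ways (`hb₂_lt_avg₂`), and
  `avg₂_not_stationary : ¬ IsStationary π₂ (avg₂Kernel T₂ pj₂)`,
  `avg₂_stationary_biased : IsStationary (15/41, 26/41) (avg₂Kernel T₂ pj₂)`: relative bias
  `4/41 ≈ 9.8 %` on state `0` (`avg₂_relative_bias`).

Use (R2-SCOPE.md §3 N1 / §5.2): the planted INVALID control X-5a must be built from independent
noises (`mcwmRate`) or from `avg₂Rate`-type averaging, never from the single shared heat-bath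
pseudofermion, which is route D1 (VALID twin V-4b).  Nothing here is specific to fermions.
-/

namespace Summit.Ventures.LatticeQCDFlow.Exactness

open Finset
open Literature.Probability.MarkovChains

/-! ## The shared-single-noise (heat-bath + Metropolis) chain on a finite space -/

section Rates

variable {X Φ : Type*} [Fintype Φ]

/-- `X`-marginal of a curried joint weight `p : X → Φ → ℝ`: `margX p x = Σ_φ p x φ` (the
exact-determinant gauge law when `p x φ = e^{-S_g(x)} e^{-φ†(D(x)D(x)†)⁻¹φ}`). [folklore] -/
noncomputable def margX (p : X → Φ → ℝ) (x : X) : ℝ := ∑ φ, p x φ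

/-- Heat-bath conditional `p(φ | x) = p x φ / margX p x`. [folklore] -/
noncomputable def hbCond (p : X → Φ → ℝ) (x : X) (φ : Φ) : ℝ := p x φ / margX p x

/-- The marginal of a positive joint weight is positive. [folklore] -/
theorem margX_pos [Nonempty Φ] {p : X → Φ → ℝ} (hp : ∀ x φ, 0 < p x φ) (x : X) :
    0 < margX p x :=
  sum_pos (fun φ _ => hp x φ) univ_nonempty

/-- The heat-bath conditional is a probability vector: `Σ_φ p(φ|x) = 1`. [folklore] -/
theorem sum_hbCond [Nonempty Φ] {p : X → Φ → ℝ} (hp : ∀ x φ, 0 < p x φ) (x : X) :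
    ∑ φ, hbCond p x φ = 1 := by
  unfold hbCond
  rw [← sum_div, div_eq_one_iff_eq (margX_pos hp x).ne']
  rfl

/-- The heat-bath conditional is positive. [folklore] -/
theorem hbCond_pos [Nonempty Φ] {p : X → Φ → ℝ} (hp : ∀ x φ, 0 < p x φ) (x : X) (φ : Φ) :
    0 < hbCond p x φ :=
  div_pos (hp x φ) (margX_pos hp x)

/-- Off-diagonal rate of the SHARED-NOISE chain on `X`: draw ONE `φ` from the current state's
conditional, propose `y ∼ T x ·`, accept with the Metropolis–Hastings rate for the conditional
target `z ↦ p z φ` at that same `φ` (numerator AND denominator use the one noise):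
`Σ_φ p(φ|x) · min (T x y) (p y φ · T y x / p x φ)`.  Venture definition (the Gibbs sampler `A_G`
of Albergo et al. 2021 §III.B; the `N_η = 1` stochastic acceptance of Knechtli–Wolff 2003 §4.1).
[folklore] -/
noncomputable def hbRate (T : X → X → ℝ) (p : X → Φ → ℝ) (x y : X) : ℝ :=
  ∑ φ, hbCond p x φ * mhRate T (fun z => p z φ) x y

/-- **The key identity**: `margX p x · hbRate T p x y = Σ_φ min (p x φ · T x y) (p y φ · T y x)` —
the heat-bath weight `p x φ / margX p x` cancels the marginal and each summand is the symmetric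
Metropolis flux for the conditional target (finite face of Knechtli–Wolff's change of variables
`η → Mη`). [folklore] -/
theorem margX_mul_hbRate [Nonempty Φ] {p : X → Φ → ℝ} (hp : ∀ x φ, 0 < p x φ) (T : X → X → ℝ)
    (x y : X) :
    margX p x * hbRate T p x y = ∑ φ, min (p x φ * T x y) (p y φ * T y x) := by
  unfold hbRate hbCond
  rw [mul_sum]
  refine sum_congr rfl fun φ _ => ?_
  rw [← mul_assoc, mul_div_cancel₀ _ (margX_pos hp x).ne']
  exact mul_mhRate (fun z => hp z φ) T x y

/-- **"Carnot" bound** (Knechtli–Wolff 2003 §4.1, `∫ min[ρ(η), ρ(Mη)] ≤ min(1, |det M|⁻²)`): the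
shared-noise acceptance is at most the exact-ratio Metropolis–Hastings rate for the marginal, for
every proposal matrix — a sum of minima is at most the minimum of the sums. [folklore] -/
theorem hbRate_le_mhRate [Nonempty Φ] {p : X → Φ → ℝ} (hp : ∀ x φ, 0 < p x φ) (T : X → X → ℝ)
    (x y : X) : hbRate T p x y ≤ mhRate T (margX p) x y := by
  refine le_of_mul_le_mul_left ?_ (margX_pos hp x)
  rw [margX_mul_hbRate hp, mul_mhRate (margX_pos hp) T x y]
  refine le_min ?_ ?_
  · calc ∑ φ, min (p x φ * T x y) (p y φ * T y x) ≤ ∑ φ, p x φ * T x y :=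
          sum_le_sum fun φ _ => min_le_left _ _
      _ = margX p x * T x y := by rw [margX, sum_mul]
  · calc ∑ φ, min (p x φ * T x y) (p y φ * T y x) ≤ ∑ φ, p y φ * T y x :=
          sum_le_sum fun φ _ => min_le_right _ _
      _ = margX p y * T y x := by rw [margX, sum_mul]

/-! ## Averaging two shared-noise estimates under the `min` -/

/-- Off-diagonal rate when the ARGUMENT of the `min` is the average of TWO independent shared-noise
ratio estimates `p y φ / p x φ` and `p y φ' / p x φ'`, both noises drawn from the current state's
conditional: `Σ_{φ,φ'} p(φ|x) p(φ'|x) · min (T x y) (T y x · (p y φ / p x φ + p y φ' / p x φ') / 2)`.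
Venture definition (the "average under the `min`" of Knechtli–Wolff 2003 §4.1 /
Finkenrath–Knechtli–Leder 2013 App. A.2, smallest case `N_η = 2`). [folklore] -/
noncomputable def avg₂Rate (T : X → X → ℝ) (p : X → Φ → ℝ) (x y : X) : ℝ :=
  ∑ φ, ∑ φ', hbCond p x φ * hbCond p x φ' *
    min (T x y) (T y x * ((p y φ / p x φ + p y φ' / p x φ') / 2))

end Rates

/-! ## The two chains on `X` (kernels, exactness of the shared-noise chain) -/

section Kernels

variable {X Φ : Type*} [Fintype X] [Fintype Φ] [DecidableEq X]

/-- The shared-noise chain's transition matrix on `X`: off-diagonal `hbRate`, rejected mass on the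
diagonal. [folklore] -/
noncomputable def hbKernel (T : X → X → ℝ) (p : X → Φ → ℝ) (x y : X) : ℝ :=
  if y = x then 1 - ∑ z ∈ univ.erase x, hbRate T p x z else hbRate T p x y

/-- Off-diagonal entries of the shared-noise kernel. [folklore] -/
theorem hbKernel_of_ne (T : X → X → ℝ) (p : X → Φ → ℝ) {x y : X} (h : y ≠ x) :
    hbKernel T p x y = hbRate T p x y := if_neg h

/-- Diagonal entries of the shared-noise kernel. [folklore] -/
theorem hbKernel_self (T : X → X → ℝ) (p : X → Φ → ℝ) (x : X) :
    hbKernel T p x x = 1 - ∑ z ∈ univ.erase x, hbRate T p x z := if_pos rfl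

/-- Rows of the shared-noise kernel sum to one. [folklore] -/
theorem hbKernel_sum_eq_one (T : X → X → ℝ) (p : X → Φ → ℝ) (x : X) :
    ∑ y, hbKernel T p x y = 1 := by
  rw [← add_sum_erase _ _ (mem_univ x), hbKernel_self]
  have : ∑ y ∈ univ.erase x, hbKernel T p x y = ∑ y ∈ univ.erase x, hbRate T p x y :=
    sum_congr rfl fun y hy => hbKernel_of_ne T p (ne_of_mem_erase hy)
  rw [this]
  ring

/-- **ONE fresh shared pseudofermion is exact**: the exact-determinant marginal `margX p` satisfies
detailed balance for the shared-noise chain, for every proposal matrix `T`.  Printed counterparts: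
Knechtli–Wolff 2003 §4.1 (`⟨w₀(A,A')⟩_η / ⟨w₀(A',A)⟩_η = |det M|⁻²` "shows detailed balance");
Albergo et al. 2021 §III.B ("This step satisfies detailed balance … and guarantees asymptotic
exactness"); Finkenrath–Knechtli–Leder 2013 App. A.2.  Venture result (VALID twin of X-5a).
[folklore] -/
theorem hb_detailedBalance [Nonempty Φ] {p : X → Φ → ℝ} (hp : ∀ x φ, 0 < p x φ)
    (T : X → X → ℝ) : DetailedBalance (margX p) (hbKernel T p) := by
  intro x y
  by_cases h : y = x
  · subst h; rfl
  · rw [hbKernel_of_ne T p h, hbKernel_of_ne T p (Ne.symm h), margX_mul_hbRate hp,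
      margX_mul_hbRate hp]
    exact sum_congr rfl fun φ _ => min_comm _ _

/-- … hence the exact-determinant marginal is STATIONARY for the shared-noise chain (exactness of
the heat-bath + Metropolis update with one fresh pseudofermion per step). [folklore] -/
theorem hb_isStationary [Nonempty Φ] {p : X → Φ → ℝ} (hp : ∀ x φ, 0 < p x φ) (T : X → X → ℝ) :
    IsStationary (margX p) (hbKernel T p) :=
  (hb_detailedBalance hp T).isStationary (hbKernel_sum_eq_one T p)

/-- Transition matrix of the two-noise-averaged chain on `X`. [folklore] -/
noncomputable def avg₂Kernel (T : X → X → ℝ) (p : X → Φ → ℝ) (x y : X) : ℝ :=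
  if y = x then 1 - ∑ z ∈ univ.erase x, avg₂Rate T p x z else avg₂Rate T p x y

/-- Off-diagonal entries of the averaged kernel. [folklore] -/
theorem avg₂Kernel_of_ne (T : X → X → ℝ) (p : X → Φ → ℝ) {x y : X} (h : y ≠ x) :
    avg₂Kernel T p x y = avg₂Rate T p x y := if_neg h

/-- Diagonal entries of the averaged kernel. [folklore] -/
theorem avg₂Kernel_self (T : X → X → ℝ) (p : X → Φ → ℝ) (x : X) :
    avg₂Kernel T p x x = 1 - ∑ z ∈ univ.erase x, avg₂Rate T p x z := if_pos rfl

/-- Rows of the averaged kernel sum to one (it IS a Markov chain on `X`). [folklore] -/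
theorem avg₂Kernel_sum_eq_one (T : X → X → ℝ) (p : X → Φ → ℝ) (x : X) :
    ∑ y, avg₂Kernel T p x y = 1 := by
  rw [← add_sum_erase _ _ (mem_univ x), avg₂Kernel_self]
  have : ∑ y ∈ univ.erase x, avg₂Kernel T p x y = ∑ y ∈ univ.erase x, avg₂Rate T p x y :=
    sum_congr rfl fun y hy => avg₂Kernel_of_ne T p (ne_of_mem_erase hy)
  rw [this]
  ring

end Kernels

/-! ## The witness on two gauge states and two pseudofermion values -/

section Witness

/-- Joint weight of the witness: `pj₂ 0 = (1/4, 1/12)`, `pj₂ 1 = (1/6, 1/2)`; its `X`-marginal is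
`π₂ = (1/3, 2/3)`. [folklore] -/
noncomputable def pj₂ : Fin 2 → Fin 2 → ℝ := ![![1 / 4, 1 / 12], ![1 / 6, 1 / 2]]

/-- Entry `(0,0)` of the joint weight. [folklore] -/
@[simp] theorem pj₂_zero_zero : pj₂ 0 0 = 1 / 4 := rfl
/-- Entry `(0,1)` of the joint weight. [folklore] -/
@[simp] theorem pj₂_zero_one : pj₂ 0 1 = 1 / 12 := rfl
/-- Entry `(1,0)` of the joint weight. [folklore] -/
@[simp] theorem pj₂_one_zero : pj₂ 1 0 = 1 / 6 := rfl
/-- Entry `(1,1)` of the joint weight. [folklore] -/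
@[simp] theorem pj₂_one_one : pj₂ 1 1 = 1 / 2 := rfl

/-- The joint weight is positive. [folklore] -/
theorem pj₂_pos (x φ : Fin 2) : 0 < pj₂ x φ := by
  fin_cases x <;> fin_cases φ <;> simp

/-- Marginal at state `0`: `1/4 + 1/12 = 1/3`. [folklore] -/
@[simp] theorem margX_pj₂_zero : margX pj₂ 0 = 1 / 3 := by
  simp only [margX, Fin.sum_univ_two, pj₂_zero_zero, pj₂_zero_one]; norm_num

/-- Marginal at state `1`: `1/6 + 1/2 = 2/3`. [folklore] -/
@[simp] theorem margX_pj₂_one : margX pj₂ 1 = 2 / 3 := by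
  simp only [margX, Fin.sum_univ_two, pj₂_one_zero, pj₂_one_one]; norm_num

/-- The `X`-marginal of the witness is the target `π₂ = (1/3, 2/3)` of `NoisyAcceptBias.lean`.
[folklore] -/
theorem margX_pj₂ : margX pj₂ = π₂ := by
  funext x
  fin_cases x
  · exact margX_pj₂_zero
  · exact margX_pj₂_one

/-- Heat-bath conditional at state `0`: `(3/4, 1/4)`. [folklore] -/
theorem hbCond_pj₂_zero : hbCond pj₂ 0 0 = 3 / 4 ∧ hbCond pj₂ 0 1 = 1 / 4 := by
  constructor <;> simp only [hbCond, margX_pj₂_zero, pj₂_zero_zero, pj₂_zero_one] <;> norm_num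

/-- Heat-bath conditional at state `1`: `(1/4, 3/4)`. [folklore] -/
theorem hbCond_pj₂_one : hbCond pj₂ 1 0 = 1 / 4 ∧ hbCond pj₂ 1 1 = 3 / 4 := by
  constructor <;> simp only [hbCond, margX_pj₂_one, pj₂_one_zero, pj₂_one_one] <;> norm_num

/-- Shared-noise rate `0 → 1`: `(3/4)·min(1/2, 1/3) + (1/4)·min(1/2, 3) = 3/8`. [folklore] -/
theorem hbRate₂_zero_one : hbRate T₂ pj₂ 0 1 = 3 / 8 := by
  simp only [hbRate, mhRate, Fin.sum_univ_two, hbCond_pj₂_zero.1, hbCond_pj₂_zero.2, T₂_apply,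
    pj₂_zero_zero, pj₂_zero_one, pj₂_one_zero, pj₂_one_one]
  norm_num [min_def]

/-- Shared-noise rate `1 → 0`: `(1/4)·min(1/2, 3/4) + (3/4)·min(1/2, 1/12) = 3/16`. [folklore] -/
theorem hbRate₂_one_zero : hbRate T₂ pj₂ 1 0 = 3 / 16 := by
  simp only [hbRate, mhRate, Fin.sum_univ_two, hbCond_pj₂_one.1, hbCond_pj₂_one.2, T₂_apply,
    pj₂_zero_zero, pj₂_zero_one, pj₂_one_zero, pj₂_one_one]
  norm_num [min_def]

/-- Sanity instance of `hb_isStationary`: `π₂` is stationary for the witness's shared-noise chain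
(`(1/3)(3/8) = 1/8 = (2/3)(3/16)`). [folklore] -/
theorem hb₂_isStationary : IsStationary π₂ (hbKernel T₂ pj₂) := by
  rw [← margX_pj₂]
  exact hb_isStationary pj₂_pos T₂

/-- Averaged rate `0 → 1`: `(9/16)(1/3) + 2·(3/16)(1/2) + (1/16)(1/2) = 13/32` — LARGER than the
exact `3/8 = 12/32`. [folklore] -/
theorem avg₂Rate₂_zero_one : avg₂Rate T₂ pj₂ 0 1 = 13 / 32 := by
  simp only [avg₂Rate, Fin.sum_univ_two, hbCond_pj₂_zero.1, hbCond_pj₂_zero.2, T₂_apply,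
    pj₂_zero_zero, pj₂_zero_one, pj₂_one_zero, pj₂_one_one]
  norm_num [min_def]

/-- Averaged rate `1 → 0`: `(1/16)(1/2) + 2·(3/16)(5/12) + (9/16)(1/12) = 15/64` — larger than
the exact `3/16 = 12/64`. [folklore] -/
theorem avg₂Rate₂_one_zero : avg₂Rate T₂ pj₂ 1 0 = 15 / 64 := by
  simp only [avg₂Rate, Fin.sum_univ_two, hbCond_pj₂_one.1, hbCond_pj₂_one.2, T₂_apply,
    pj₂_zero_zero, pj₂_zero_one, pj₂_one_zero, pj₂_one_one]
  norm_num [min_def]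

/-- Averaging under the `min` RAISES the acceptance in both directions (the temptation:
`3/8 < 13/32` and `3/16 < 15/64`). [folklore] -/
theorem hb₂_lt_avg₂ :
    hbRate T₂ pj₂ 0 1 < avg₂Rate T₂ pj₂ 0 1 ∧ hbRate T₂ pj₂ 1 0 < avg₂Rate T₂ pj₂ 1 0 := by
  rw [hbRate₂_zero_one, avg₂Rate₂_zero_one, hbRate₂_one_zero, avg₂Rate₂_one_zero]
  norm_num

/-- `univ.erase 0 = {1}` in `Fin 2` (private helper). [folklore] -/
private theorem erase_zero₂' : (univ : Finset (Fin 2)).erase 0 = {1} := by decide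
/-- `univ.erase 1 = {0}` in `Fin 2` (private helper). [folklore] -/
private theorem erase_one₂' : (univ : Finset (Fin 2)).erase 1 = {0} := by decide

/-- The four entries of the averaged kernel of the witness. [folklore] -/
theorem avg₂Kernel₂_entries :
    avg₂Kernel T₂ pj₂ 0 1 = 13 / 32 ∧ avg₂Kernel T₂ pj₂ 1 0 = 15 / 64 ∧
      avg₂Kernel T₂ pj₂ 0 0 = 19 / 32 ∧ avg₂Kernel T₂ pj₂ 1 1 = 49 / 64 := by
  refine ⟨?_, ?_, ?_, ?_⟩
  · rw [avg₂Kernel_of_ne _ _ (by decide), avg₂Rate₂_zero_one]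
  · rw [avg₂Kernel_of_ne _ _ (by decide), avg₂Rate₂_one_zero]
  · rw [avg₂Kernel_self, erase_zero₂', sum_singleton, avg₂Rate₂_zero_one]; norm_num
  · rw [avg₂Kernel_self, erase_one₂', sum_singleton, avg₂Rate₂_one_zero]; norm_num

/-- **Averaging two shared-noise estimates under the `min` is NOT exact**: the exact-determinant
marginal `π₂ = (1/3, 2/3)` is not stationary for the averaged chain (flow into state `1`:
`(1/3)(13/32) + (2/3)(49/64) = 31/48 ≠ 2/3`), although each of the two estimates alone gives an
exact chain (`hb₂_isStationary`).  Printed statement: "it is not possible to perform the average of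
the argument under the `min` function over many pseudofermions, as this violates detailed balance"
(Finkenrath–Knechtli–Leder 2013 App. A.2; Knechtli–Wolff 2003 §4.1); here refuted-by-witness in the
smallest model.  Venture result (admissible form of the planted control X-5a). [folklore] -/
theorem avg₂_not_stationary : ¬ IsStationary π₂ (avg₂Kernel T₂ pj₂) := by
  intro h
  have h1 := h 1
  obtain ⟨h01, -, -, h11⟩ := avg₂Kernel₂_entries
  rw [Fin.sum_univ_two, h01, h11, π₂_zero, π₂_one] at h1
  norm_num at h1

/-- The law the averaged chain DOES sample: `(15/41, 26/41)` is stationary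
(`(15/41)(13/32) = (26/41)(15/64)`). [folklore] -/
theorem avg₂_stationary_biased :
    IsStationary ![(15 : ℝ) / 41, 26 / 41] (avg₂Kernel T₂ pj₂) := by
  obtain ⟨h01, h10, h00, h11⟩ := avg₂Kernel₂_entries
  intro y
  fin_cases y
  · simp only [Fin.sum_univ_two, Fin.zero_eta, Matrix.cons_val_zero, Matrix.cons_val_one, h00, h10]
    norm_num
  · simp only [Fin.sum_univ_two, Fin.mk_one, Matrix.cons_val_zero, Matrix.cons_val_one, h01, h11]
    norm_num

/-- Size of the defect: stationary weight of state `0` is `15/41` instead of `1/3`, a relative bias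
of `4/41` (≈ 9.8 %); for comparison the independent-noise chain of `NoisyAcceptBias.lean` has
`4/35`. [folklore] -/
theorem avg₂_relative_bias : ((15 : ℝ) / 41 - 1 / 3) / (1 / 3) = 4 / 41 := by norm_num

end Witness

end Summit.Ventures.LatticeQCDFlow.Exactness
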